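import Literature.AnabelianGeometry.AbsoluteAnabelian.AbsTopIII.FrobeniusPictureMLFLogGlueFamilyEta
import Literature.AnabelianGeometry.AbsoluteAnabelian.DiagramShiftInvariance

/-!
# [AbsTopIII] Corollary 3.6 (v), third sentence — the `𝔖_log` part: the observable of (iii) is invariant
# under the translation of the first row

S. Mochizuki, *Topics in Absolute Anabelian Geometry III*, Cor. 3.6 (iii), (v) pp. 80–81 of the kurims
manuscript (`paper:url-5493eb38cbb7`; bib key `MochizukiAbsTopIII2015`).  Seat abc-iut-w6-d023 (row
«Cor36-SHIFT», §(v) of the abc-iut-L4-t5 blueprint; sequel of `FrobeniusPictureMLFShiftCores.lean`).  Print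
(proof of (v), p. 82: "follows immediately from the definitions"): the homotopies `ι_{log,⋎}`, `ι_×` of the
observable `𝔖_log` of (iii) do not depend on the index `⋎`, so translating the first row by `m` maps the
boundary set `E_log` (the saturation of the type-(1)/(2) pairs, proof of (iii) p. 81) to itself and the
homotopies to themselves.  Typed: the translation `shiftLog m` of the presentation `𝒟_{≤3} = 𝒟_{≤2} ∪ {𝒩}`
(`logObsShape`, `sub3`), under which `𝒟_{≤3}` is invariant (`sub3_comapAlong_shiftLog`); the generators
`LogGen` and their saturation are stable (`saturation_logGen_shiftLog`); and for ANY family `H₃` that IS the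
`𝔖_log` family (`IsLogObservableFamily`: generated by `LogGen`, pinned to `ι_{log,⋎}`, `ι_×` on the
generators) the homotopies are invariant: `ζ_{(shift γ₁, shift γ₂)} ≍ ζ_{(γ₁,γ₂)}`
(`IsLogObservableFamily.η_shiftLog_heq`, by induction on the saturation).  Pure combinatorics / category
theory over the typed data; nothing here bears on [IUTchIII] Cor. 3.12; no side is taken on inter-universal
Teichmüller theory.
-/

namespace Literature.AnabelianGeometry.AbsoluteAnabelian

open _root_.CategoryTheory _root_.Quiver

universe u

namespace LogFrobeniusData

open DiagramOfCategories

/-! ### The translation of `𝒟_{≤3}` (presentation `𝒟_{≤2} ∪ {𝒩}`) -/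

/-- Translation by `m` of the first row of `Γ⃗_{𝒟_{≤3}}` (vertices): `⋎ ↦ ⋎ + m`, `□`, `𝒩` fixed.
[cite: MochizukiAbsTopIII2015, Corollary 3.6 (v) p.80] -/
def shiftLogObj (m : ℤ) : logObsShape.{u}.Vertex → logObsShape.{u}.Vertex
  | ExtVertex.base ⟨.row1 n, _⟩ => lvRow1 (n + m)
  | ExtVertex.base ⟨.nexus, h⟩ => ExtVertex.base ⟨.nexus, h⟩
  | ExtVertex.base ⟨.third, h⟩ => ExtVertex.base ⟨.third, h⟩
  | ExtVertex.base ⟨.fourth, h⟩ => ExtVertex.base ⟨.fourth, h⟩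
  | ExtVertex.base ⟨.fifth, h⟩ => ExtVertex.base ⟨.fifth, h⟩
  | ExtVertex.base ⟨.sixth, h⟩ => ExtVertex.base ⟨.sixth, h⟩
  | ExtVertex.obs => ExtVertex.obs

/-- Translation by `m` of the first row of `Γ⃗_{𝒟_{≤3}}` (edges): `log`, `id_⋎` go to `log`, `id_{⋎+m}`; the
observation edges `λ^×`, `λ^{×pf}` are fixed. [cite: MochizukiAbsTopIII2015, Corollary 3.6 (v) p.80] -/
def shiftLogHom (m : ℤ) : ∀ {a b : logObsShape.{u}.Vertex}, (a ⟶ b) → (shiftLogObj m a ⟶ shiftLogObj m b) := by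
  intro a b e
  rcases a with ⟨_ | _ | _ | _ | _ | _, ha⟩ | _ <;> rcases b with ⟨_ | _ | _ | _ | _ | _, hb⟩ | _ <;>
    first
      | exact (PEmpty.elim e)
      | exact e
      | exact ULift.up (PLift.up (by have h := (ULift.down e).down; omega))

/-- **The translation `shiftLog m` of `𝒟_{≤3}`** as a morphism of oriented graphs.
[cite: MochizukiAbsTopIII2015, Corollary 3.6 (v) p.80] -/
def shiftLog (m : ℤ) : logObsShape.{u}.Vertex ⥤q logObsShape.{u}.Vertex where
  obj := shiftLogObj m
  map e := shiftLogHom m e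

/-- `shiftLog m ⋙ shiftLog m' = shiftLog (m + m')`. [cite: MochizukiAbsTopIII2015, Corollary 3.6 (v) p.80] -/
theorem shiftLog_comp (m m' : ℤ) : shiftLog.{u} m ⋙q shiftLog.{u} m' = shiftLog.{u} (m + m') := by
  refine Prefunctor.ext (fun X => ?_) (fun X Y f => ?_)
  · rcases X with ⟨_ | _ | _ | _ | _ | _, hX⟩ | _ <;>
      first | rfl | (change lvRow1 (_ + m + m') = lvRow1 (_ + (m + m')); rw [Int.add_assoc])
  · rcases X with ⟨_ | _ | _ | _ | _ | _, hX⟩ | _ <;> rcases Y with ⟨_ | _ | _ | _ | _ | _, hY⟩ | _ <;>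
      first
        | exact (PEmpty.elim f)
        | exact Subsingleton.elim _ _
        | rfl

/-- `shiftLog 0 = id`. [cite: MochizukiAbsTopIII2015, Corollary 3.6 (v) p.80] -/
theorem shiftLog_zero : shiftLog.{u} 0 = 𝟭q logObsShape.{u}.Vertex := by
  refine Prefunctor.ext (fun X => ?_) (fun X Y f => ?_)
  · rcases X with ⟨_ | _ | _ | _ | _ | _, hX⟩ | _ <;>
      first | rfl | (change lvRow1 (_ + 0) = lvRow1 _; rw [Int.add_zero])
  · rcases X with ⟨_ | _ | _ | _ | _ | _, hX⟩ | _ <;> rcases Y with ⟨_ | _ | _ | _ | _ | _, hY⟩ | _ <;>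
      first
        | exact (PEmpty.elim f)
        | exact Subsingleton.elim _ _
        | rfl

/-- `shiftLog m ⋙ shiftLog (-m) = id`. [cite: MochizukiAbsTopIII2015, Corollary 3.6 (v) p.80] -/
theorem shiftLog_comp_neg (m : ℤ) : shiftLog.{u} m ⋙q shiftLog.{u} (-m) = 𝟭q logObsShape.{u}.Vertex := by
  rw [shiftLog_comp, Int.add_right_neg, shiftLog_zero]

variable (Δ : LogFrobeniusData.{u})

/-- **`𝒟_{≤3}` is invariant under the translation**: `(shiftLog m)^*𝒟_{≤3} = 𝒟_{≤3}`.
[cite: MochizukiAbsTopIII2015, Corollary 3.6 (v) p.80] -/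
theorem sub3_comapAlong_shiftLog (m : ℤ) : Δ.sub3.comapAlong (shiftLog.{u} m) = Δ.sub3 :=
  DiagramOfCategories.ext'
    (fun a => by rcases a with ⟨_ | _ | _ | _ | _ | _, ha⟩ | _ <;> rfl)
    (fun a => by rcases a with ⟨_ | _ | _ | _ | _ | _, ha⟩ | _ <;> exact HEq.rfl)
    (fun {a b} e => by
      rcases a with ⟨_ | _ | _ | _ | _ | _, ha⟩ | _ <;> rcases b with ⟨_ | _ | _ | _ | _ | _, hb⟩ | _ <;>
        first | exact (PEmpty.elim e) | exact HEq.rfl)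


/-! ### The generators of `E_log` and their saturation are stable under the translation -/

section PathHEq

variable {W : Type*} [Quiver W]

/-- Empty paths at equal vertices agree (heterogeneously). [cite: MochizukiAbsTopIII2015, Section 0 p.26] -/
theorem heq_path_nil {a a' : W} (ha : a = a') : HEq (Path.nil : Path a a) (Path.nil : Path a' a') := by
  subst ha; rfl

/-- Extending heterogeneously equal paths by heterogeneously equal edges. [cite: MochizukiAbsTopIII2015, Section 0 p.26] -/
theorem heq_path_cons {a a' b b' c c' : W} (ha : a = a') (hb : b = b') (hc : c = c') {p : Path a b}
    {p' : Path a' b'} (hp : HEq p p') {e : b ⟶ c} {e' : b' ⟶ c'} (he : HEq e e') :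
    HEq (p.cons e) (p'.cons e') := by
  subst ha; subst hb; subst hc; cases hp; cases he; rfl

/-- Edges in a subsingleton hom-type at equal endpoints agree (heterogeneously). [cite: MochizukiAbsTopIII2015, Section 0 p.26] -/
theorem heq_hom_of_subsingleton {a a' b b' : W} (ha : a = a') (hb : b = b') (e : a ⟶ b) (e' : a' ⟶ b')
    (hs : ∀ x y : a' ⟶ b', x = y) : HEq e e' := by
  subst ha; subst hb; exact heq_of_eq (hs e e')

/-- The saturation of a set of pairs is stable under heterogeneous re-indexing of the pair (equal endpoints).
[cite: MochizukiAbsTopIII2015, Section 0 p.27] -/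
theorem Saturation.of_heq {E₀ : ∀ ⦃a b : W⦄, Path a b → Path a b → Prop} {a a' b b' : W} (ha : a = a')
    (hb : b = b') {p q : Path a b} {p' q' : Path a' b'} (hp : HEq p p') (hq : HEq q q')
    (h : Saturation E₀ p q) : Saturation E₀ p' q' := by
  subst ha; subst hb; cases hp; cases hq; exact h

end PathHEq

/-- `⋎ + m + 1 = ⋎ + 1 + m` on the first row of `𝒟_{≤3}`. [cite: MochizukiAbsTopIII2015, Corollary 3.6 (v) p.80] -/
theorem lvRow1_add_add_one (m n : ℤ) : lvRow1.{u} (n + m + 1) = lvRow1.{u} (n + 1 + m) := by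
  rw [Int.add_right_comm]

/-- The translation maps the type-(1) left path `[λ^×]∘[id_⋎]∘[log]` from `⋎+1` to the one from `⋎+1+m`.
[cite: MochizukiAbsTopIII2015, Corollary 3.6 (iii) p.81] -/
theorem shiftLog_mapPath_logPairLeft_heq (m n : ℤ) :
    HEq ((shiftLog.{u} m).mapPath (logPairLeft.{u} n)) (logPairLeft.{u} (n + m)) := by
  have hv₀ : (shiftLog.{u} m).obj (lvRow1 (n + 1)) = lvRow1 (n + m + 1) := (lvRow1_add_add_one m n).symm
  unfold logPairLeft
  simp only [Prefunctor.mapPath_cons, Prefunctor.mapPath_nil]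
  exact heq_path_cons hv₀ rfl rfl
    (heq_path_cons hv₀ rfl rfl
      (heq_path_cons hv₀ hv₀ rfl (heq_path_nil hv₀)
        (heq_hom_of_subsingleton hv₀ rfl _ _ (fun x y => by
          obtain ⟨⟨_⟩⟩ := x; obtain ⟨⟨_⟩⟩ := y; rfl)))
      HEq.rfl)
    HEq.rfl

/-- The translation maps the type-(1) right path `[λ^{×pf}]∘[id_{⋎+1}]` from `⋎+1` to the one from `⋎+1+m`.
[cite: MochizukiAbsTopIII2015, Corollary 3.6 (iii) p.81] -/
theorem shiftLog_mapPath_logPairRight_heq (m n : ℤ) :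
    HEq ((shiftLog.{u} m).mapPath (logPairRight.{u} n)) (logPairRight.{u} (n + m)) := by
  have hv₀ : (shiftLog.{u} m).obj (lvRow1 (n + 1)) = lvRow1 (n + m + 1) := (lvRow1_add_add_one m n).symm
  unfold logPairRight
  simp only [Prefunctor.mapPath_cons, Prefunctor.mapPath_nil]
  exact heq_path_cons hv₀ rfl rfl
    (heq_path_cons hv₀ hv₀ rfl (heq_path_nil hv₀) (heq_hom_of_subsingleton hv₀ rfl _ _ (fun x y => rfl)))
    HEq.rfl

/-- The translation fixes the type-(2) left path. [cite: MochizukiAbsTopIII2015, Corollary 3.6 (iii) p.81] -/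
theorem shiftLog_mapPath_timesPairLeft (m : ℤ) :
    (shiftLog.{u} m).mapPath Δ.timesPairLeft = Δ.timesPairLeft := by
  unfold timesPairLeft
  split <;> rfl

/-- The translation fixes the type-(2) right path. [cite: MochizukiAbsTopIII2015, Corollary 3.6 (iii) p.81] -/
theorem shiftLog_mapPath_timesPairRight (m : ℤ) :
    (shiftLog.{u} m).mapPath Δ.timesPairRight = Δ.timesPairRight := by
  unfold timesPairRight
  split <;> rfl

/-- **`E_log` is stable under the translation**: the saturation of the type-(1)/(2) pairs is mapped into
itself by `shiftLog m` (type (1) at `⋎` goes to type (1) at `⋎ + m`, type (2) is fixed).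
[cite: MochizukiAbsTopIII2015, Corollary 3.6 (iii) p.81] -/
theorem saturation_logGen_shiftLog (m : ℤ) {a b : logObsShape.{u}.Vertex} {p q : Path a b}
    (h : Saturation Δ.LogGen p q) :
    Saturation Δ.LogGen ((shiftLog.{u} m).mapPath p) ((shiftLog.{u} m).mapPath q) := by
  induction h with
  | base hg =>
    cases hg with
    | type1 n =>
      exact Saturation.of_heq (lvRow1_add_add_one m n) rfl (shiftLog_mapPath_logPairLeft_heq m n).symm
        (shiftLog_mapPath_logPairRight_heq m n).symm (Saturation.base (LogGen.type1 (n + m)))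
    | type2 =>
      rw [shiftLog_mapPath_timesPairLeft, shiftLog_mapPath_timesPairRight]
      exact Saturation.base LogGen.type2
  | refl_left _ ih => exact ih.refl_left
  | refl_right _ ih => exact ih.refl_right
  | trans _ _ ih₁ ih₂ => exact ih₁.trans ih₂
  | precomp r _ ih => rw [Prefunctor.mapPath_comp, Prefunctor.mapPath_comp]; exact ih.precomp _
  | postcomp r _ ih => rw [Prefunctor.mapPath_comp, Prefunctor.mapPath_comp]; exact ih.postcomp _


/-! ### The `𝔖_log` family is invariant under the translation -/

section FamilyHEq

universe v' u' w'

variable {W : Type w'} [Quiver.{v'} W] {D : DiagramOfCategories.{v', u', w'} W} (H : D.HomotopyFamily)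

/-- Re-indexing a homotopy along equal pairs of paths (heterogeneous form).
[cite: MochizukiAbsTopIII2015, Definition 3.5 (ii) p.75] -/
theorem _root_.Literature.AnabelianGeometry.AbsoluteAnabelian.DiagramOfCategories.HomotopyFamily.η_heq_of_path_eq
    {a b : W} {p p' q q' : Path a b} (hp : p = p') (hq : q = q') (h : H.E p q) (h' : H.E p' q') :
    HEq (H.η h') (H.η h) := by
  subst hp; subst hq; rfl

/-- Re-indexing a homotopy along heterogeneously equal pairs of paths with equal sources.
[cite: MochizukiAbsTopIII2015, Definition 3.5 (ii) p.75] -/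
theorem _root_.Literature.AnabelianGeometry.AbsoluteAnabelian.DiagramOfCategories.HomotopyFamily.η_heq_of_path_heq
    {a a' b : W} (ha : a = a') {p q : Path a b} {p' q' : Path a' b} (hp : HEq p p') (hq : HEq q q')
    (h : H.E p q) (h' : H.E p' q') : HEq (H.η h') (H.η h) := by
  subst ha; cases hp; cases hq; rfl

/-- Natural transformations between equal functors with heterogeneously equal components agree.
[cite: MochizukiAbsTopIII2015, Definition 3.5 (ii) p.75] -/
theorem _root_.Literature.AnabelianGeometry.AbsoluteAnabelian.NatTrans.heq_of_app_heq {A B : Type u'}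
    [Category.{v'} A] [Category.{v'} B] {P Q P' Q' : A ⥤ B} (hP : P = P') (hQ : Q = Q') {θ : P ⟶ Q}
    {θ' : P' ⟶ Q'} (h : ∀ x, HEq (θ.app x) (θ'.app x)) : HEq θ θ' := by
  subst hP; subst hQ
  exact heq_of_eq (NatTrans.ext (funext fun x => eq_of_heq (h x)))

/-- Left whiskering respects heterogeneous equality, all three categories varying along propositional
equalities. [cite: MochizukiAbsTopIII2015, Definition 3.5 (ii) p.75] -/
theorem _root_.Literature.AnabelianGeometry.AbsoluteAnabelian.Functor.whiskerLeft_heq'' {A A' B B' C C' : Type u'}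
    [iA : Category.{v'} A] [iA' : Category.{v'} A'] [iB : Category.{v'} B] [iB' : Category.{v'} B']
    [iC : Category.{v'} C] [iC' : Category.{v'} C'] (hA : A = A') (hiA : HEq iA iA') (hB : B = B')
    (hiB : HEq iB iB') (hC : C = C') (hiC : HEq iC iC') {R : A ⥤ B} {R' : A' ⥤ B'} (hR : HEq R R')
    {F G : B ⥤ C} {F' G' : B' ⥤ C'} (hF : HEq F F') (hG : HEq G G') {α : F ⟶ G} {α' : F' ⟶ G'}
    (hα : HEq α α') : HEq (Functor.whiskerLeft R α) (Functor.whiskerLeft R' α') := by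
  subst hA; subst hB; subst hC; cases hiA; cases hiB; cases hiC; cases hR; cases hF; cases hG; cases hα; rfl

/-- Composition of functors respects heterogeneous equality, all three categories varying along propositional
equalities. [cite: MochizukiAbsTopIII2015, Definition 3.5 (i) p.75] -/
theorem _root_.Literature.AnabelianGeometry.AbsoluteAnabelian.Functor.comp_heq'' {A A' B B' C C' : Type u'}
    [iA : Category.{v'} A] [iA' : Category.{v'} A'] [iB : Category.{v'} B] [iB' : Category.{v'} B']
    [iC : Category.{v'} C] [iC' : Category.{v'} C'] (hA : A = A') (hiA : HEq iA iA') (hB : B = B')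
    (hiB : HEq iB iB') (hC : C = C') (hiC : HEq iC iC') {F : A ⥤ B} {F' : A' ⥤ B'} (hF : HEq F F')
    {T : B ⥤ C} {T' : B' ⥤ C'} (hT : HEq T T') : HEq (F ⋙ T) (F' ⋙ T') := by
  subst hA; subst hB; subst hC; cases hiA; cases hiB; cases hiC; cases hF; cases hT; rfl

end FamilyHEq

variable {Δ}

variable (Δ) in
/-- The path functor of the type-(1) left path `[λ^×]∘[id_⋎]∘[log]` is `λ^× ∘ id ∘ log` (for every `⋎`).
[cite: MochizukiAbsTopIII2015, Corollary 3.6 (iii) p.81] -/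
theorem sub3_pathFunctor_logPairLeft (k : ℤ) :
    Δ.sub3.pathFunctor (logPairLeft.{u} k) = ((𝟭 Δ.X₁ ⋙ Δ.log) ⋙ Δ.toNexus) ⋙ Δ.lamTimes := by
  simp only [logPairLeft, pathFunctor_cons, pathFunctor_nil]
  rfl

variable (Δ) in
/-- The path functor of the type-(1) right path `[λ^{×pf}]∘[id_{⋎+1}]` is `λ^{×pf} ∘ id` (for every `⋎`).
[cite: MochizukiAbsTopIII2015, Corollary 3.6 (iii) p.81] -/
theorem sub3_pathFunctor_logPairRight (k : ℤ) :
    Δ.sub3.pathFunctor (logPairRight.{u} k) = (𝟭 Δ.X₁ ⋙ Δ.toNexus) ⋙ Δ.lamPf := by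
  simp only [logPairRight, pathFunctor_cons, pathFunctor_nil]
  rfl

/-- On a type-(1) pair the homotopy of the `𝔖_log` family is `ι_{log,⋎}` componentwise (heterogeneously; the
pinning `LogPinned`). [cite: MochizukiAbsTopIII2015, Corollary 3.6 (iii) p.81] -/
theorem IsLogObservableFamily.η_logPair_app_heq {H₃ : Δ.sub3.HomotopyFamily} (hH : Δ.IsLogObservableFamily H₃)
    (k : ℤ) (hk : H₃.E (logPairLeft k) (logPairRight k)) (x : Δ.X₁) :
    HEq ((H₃.η hk).app x) (Δ.ιlog.app x) := by
  obtain ⟨h₀, hpin⟩ := hH.2.2.2 k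
  have e₁ : (Δ.sub3.pathFunctor (logPairLeft.{u} k)).obj x = Δ.lamTimes.obj (Δ.toNexus.obj (Δ.log.obj x)) := by
    rw [Δ.sub3_pathFunctor_logPairLeft k]; rfl
  have e₂ : (Δ.sub3.pathFunctor (logPairRight.{u} k)).obj x = Δ.lamPf.obj (Δ.toNexus.obj x) := by
    rw [Δ.sub3_pathFunctor_logPairRight k]; rfl
  exact (conj_eqToHom_iff_heq _ _ e₁ e₂).mp (hpin x e₁ e₂)

/-- **`ι_{log,⋎}` does not depend on `⋎`**: the homotopies of the `𝔖_log` family on the type-(1) pairs at `⋎`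
and at `⋎'` agree. [cite: MochizukiAbsTopIII2015, Corollary 3.6 (iii) p.81] -/
theorem IsLogObservableFamily.η_logPair_heq {H₃ : Δ.sub3.HomotopyFamily} (hH : Δ.IsLogObservableFamily H₃)
    (n k : ℤ) (hn' : H₃.E (logPairLeft n) (logPairRight n)) (hk : H₃.E (logPairLeft k) (logPairRight k)) :
    HEq (H₃.η hk) (H₃.η hn') :=
  NatTrans.heq_of_app_heq
    ((Δ.sub3_pathFunctor_logPairLeft k).trans (Δ.sub3_pathFunctor_logPairLeft n).symm)
    ((Δ.sub3_pathFunctor_logPairRight k).trans (Δ.sub3_pathFunctor_logPairRight n).symm)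
    fun x => (hH.η_logPair_app_heq k hk x).trans (hH.η_logPair_app_heq n hn' x).symm

/-- **The `𝔖_log` family is invariant under the translation of the first row**: for a family `H₃` on `𝒟_{≤3}`
that IS the observable `𝔖_log` (generated by the type-(1)/(2) pairs, pinned to `ι_{log,⋎}`, `ι_×`) and every
boundary pair `([γ₁],[γ₂])`, the homotopy of `(shift γ₁, shift γ₂)` is (heterogeneously) that of
`([γ₁],[γ₂])` — proof of (v), p. 82: "follows immediately from the definitions".
[cite: MochizukiAbsTopIII2015, Corollary 3.6 (v) p.80] -/
theorem IsLogObservableFamily.η_shiftLog_heq {H₃ : Δ.sub3.HomotopyFamily} (hH : Δ.IsLogObservableFamily H₃)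
    (m : ℤ) {a b : logObsShape.{u}.Vertex} {p q : Path a b} (h : H₃.E p q)
    (h' : H₃.E ((shiftLog.{u} m).mapPath p) ((shiftLog.{u} m).mapPath q)) : HEq (H₃.η h') (H₃.η h) := by
  have hD := Δ.sub3_comapAlong_shiftLog m
  have hA : ∀ c : logObsShape.{u}.Vertex, Δ.sub3.obj ((shiftLog.{u} m).obj c) = Δ.sub3.obj c :=
    Δ.sub3.obj_eq_of_comapAlong_eq _ hD
  have hiA : ∀ c : logObsShape.{u}.Vertex, HEq (Δ.sub3.cat ((shiftLog.{u} m).obj c)) (Δ.sub3.cat c) :=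
    Δ.sub3.cat_heq_of_comapAlong_eq _ hD
  have hP : ∀ {c d : logObsShape.{u}.Vertex} (r : Path c d),
      HEq (Δ.sub3.pathFunctor ((shiftLog.{u} m).mapPath r)) (Δ.sub3.pathFunctor r) :=
    fun r => Δ.sub3.pathFunctor_mapPath_heq _ hD r
  have hsE : ∀ {c d : logObsShape.{u}.Vertex} {r s : Path c d}, Saturation Δ.LogGen r s →
      H₃.E ((shiftLog.{u} m).mapPath r) ((shiftLog.{u} m).mapPath s) :=
    fun hrs => (hH.1 _ _).mpr (Δ.saturation_logGen_shiftLog m hrs)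
  have hs := (hH.1 p q).mp h
  induction hs with
  | base hg =>
    cases hg with
    | type1 n =>
      obtain ⟨hk, _⟩ := hH.2.2.2 (n + m)
      exact (H₃.η_heq_of_path_heq (lvRow1_add_add_one m n) (shiftLog_mapPath_logPairLeft_heq m n).symm
        (shiftLog_mapPath_logPairRight_heq m n).symm hk h').trans (hH.η_logPair_heq n (n + m) h hk)
    | type2 =>
      exact H₃.η_heq_of_path_eq (Δ.shiftLog_mapPath_timesPairLeft m).symm
        (Δ.shiftLog_mapPath_timesPairRight m).symm h h'
  | refl_left _ _ =>
    rw [H₃.η_refl, H₃.η_refl]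
    exact NatTrans.id_heq' (hA _) (hiA _) (hA _) (hiA _) (hP _)
  | refl_right _ _ =>
    rw [H₃.η_refl, H₃.η_refl]
    exact NatTrans.id_heq' (hA _) (hiA _) (hA _) (hiA _) (hP _)
  | trans h₁ h₂ ih₁ ih₂ =>
    rename_i c d p₀ q₀ r₀
    have hpq : H₃.E p₀ q₀ := (hH.1 _ _).mpr h₁
    have hqr : H₃.E q₀ r₀ := (hH.1 _ _).mpr h₂
    have e₁ : H₃.η h = H₃.η hpq ≫ H₃.η hqr := H₃.η_trans hpq hqr
    have e₂ : H₃.η h' = H₃.η (hsE h₁) ≫ H₃.η (hsE h₂) := H₃.η_trans (hsE h₁) (hsE h₂)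
    rw [e₁, e₂]
    exact NatTrans.comp_heq' (hA _) (hiA _) (hA _) (hiA _) (hP _) (hP _) (hP _) (ih₁ hpq (hsE h₁))
      (ih₂ hqr (hsE h₂))
  | precomp r h₁ ih =>
    rename_i c d c' p₀ q₀
    have hpq : H₃.E p₀ q₀ := (hH.1 _ _).mpr h₁
    have e₁ : H₃.η h = _ := H₃.η_whisker hpq r Path.nil
    have h₂ : H₃.E (((shiftLog.{u} m).mapPath r).comp ((shiftLog.{u} m).mapPath p₀))
        (((shiftLog.{u} m).mapPath r).comp ((shiftLog.{u} m).mapPath q₀)) := by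
      rw [← Prefunctor.mapPath_comp, ← Prefunctor.mapPath_comp]; exact h'
    have e₂ : H₃.η h₂ = _ := H₃.η_whisker (hsE h₁) ((shiftLog.{u} m).mapPath r) Path.nil
    refine (H₃.η_heq_of_path_eq (Prefunctor.mapPath_comp _ r p₀).symm (Prefunctor.mapPath_comp _ r q₀).symm
      h₂ h').trans ?_
    rw [e₁, e₂]
    refine eqToHom_comp_comp_eqToHom_heq_of_heq _ _ _
      (HEq.symm (eqToHom_comp_comp_eqToHom_heq_of_heq _ _ _ (HEq.symm ?_)))
    exact Functor.whiskerLeft_heq'' (hA _) (hiA _) (hA _) (hiA _) (hA _) (hiA _) (hP r)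
      (Functor.comp_heq'' (hA _) (hiA _) (hA _) (hiA _) (hA _) (hiA _) (hP p₀) (hP (Path.nil : Path d d)))
      (Functor.comp_heq'' (hA _) (hiA _) (hA _) (hiA _) (hA _) (hiA _) (hP q₀) (hP (Path.nil : Path d d)))
      (Functor.whiskerRight_heq'' (hA _) (hiA _) (hA _) (hiA _) (hA _) (hiA _) (hP p₀) (hP q₀)
        (ih hpq (hsE h₁)) (hP (Path.nil : Path d d)))
  | postcomp r h₁ ih =>
    rename_i c d d' p₀ q₀
    have hpq : H₃.E p₀ q₀ := (hH.1 _ _).mpr h₁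
    have h₁₀ : H₃.E (Path.nil.comp (p₀.comp r)) (Path.nil.comp (q₀.comp r)) := by
      rw [Path.nil_comp, Path.nil_comp]; exact h
    have e₁ : H₃.η h₁₀ = _ := H₃.η_whisker hpq Path.nil r
    have h₂₀ : H₃.E (Path.nil.comp (((shiftLog.{u} m).mapPath p₀).comp ((shiftLog.{u} m).mapPath r)))
        (Path.nil.comp (((shiftLog.{u} m).mapPath q₀).comp ((shiftLog.{u} m).mapPath r))) := by
      rw [Path.nil_comp, Path.nil_comp, ← Prefunctor.mapPath_comp, ← Prefunctor.mapPath_comp]; exact h'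
    have e₂ : H₃.η h₂₀ = _ := H₃.η_whisker (hsE h₁) Path.nil ((shiftLog.{u} m).mapPath r)
    refine (H₃.η_heq_of_path_eq (by rw [Path.nil_comp, Prefunctor.mapPath_comp])
      (by rw [Path.nil_comp, Prefunctor.mapPath_comp]) h₂₀ h').trans ?_
    refine HEq.trans ?_ (H₃.η_heq_of_path_eq (Path.nil_comp _).symm (Path.nil_comp _).symm h h₁₀)
    rw [e₁, e₂]
    refine eqToHom_comp_comp_eqToHom_heq_of_heq _ _ _
      (HEq.symm (eqToHom_comp_comp_eqToHom_heq_of_heq _ _ _ (HEq.symm ?_)))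
    exact Functor.whiskerLeft_heq'' (hA _) (hiA _) (hA _) (hiA _) (hA _) (hiA _) (hP (Path.nil : Path c c))
      (Functor.comp_heq'' (hA _) (hiA _) (hA _) (hiA _) (hA _) (hiA _) (hP p₀) (hP r))
      (Functor.comp_heq'' (hA _) (hiA _) (hA _) (hiA _) (hA _) (hiA _) (hP q₀) (hP r))
      (Functor.whiskerRight_heq'' (hA _) (hiA _) (hA _) (hiA _) (hA _) (hiA _) (hP p₀) (hP q₀)
        (ih hpq (hsE h₁)) (hP r))

end LogFrobeniusData

end Literature.AnabelianGeometry.AbsoluteAnabelian
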